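import Literature.MathematicalPhysics.QuantumFieldTheory.Balaban1983to89.T3OrbitAverage
import Literature.MathematicalPhysics.QuantumFieldTheory.Balaban1983to89.T3CentreTwistUnitLaw

/-!
# `Balaban1983to89.T3ContinuumUnitLaw` — rung R3 at unit resolution: (E3) ⇔ THE GAUGE-INVARIANT UNIT LAWS CONVERGE WEAKLY
# on the compact configuration space `SU(2)^{bonds(T₁)}`; THE continuum unit law, its gauge invariance and its moments; its
# CONSISTENCY UNDER BLOCK AVERAGING across resolutions (`SU(2)`, `ℰ = expMeanLogSUc`)

Cell `ym3-torus` (HUMAN RULING D-0037, YM ladder rung R3), seat `ym3-torus-p2` gen 2 (E3-node holder).  WHAT THIS IS NOT: not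
d = 4, not infinite volume, not a mass gap (`CrossoverControl` stays open), not Clay, and NOT (E3): every theorem is keyed on
`h : HasContinuumLimit (F.scheme ℰc γ)` or is an equivalence with it.  What it gives is the OBJECT: under (E3) the d = 3 continuum
theory at unit resolution is ONE gauge-invariant Borel probability measure on `SU(2)^{bonds(T₁)}` — the law of the FAT
(tube-smeared, [Balaban1987RG1] (0.4)) unit-scale bond variables — of which the continuum loop expectations are the moments,
and these laws at the resolutions `L^{-n}`, `n ≥ 0`, form a family CONSISTENT under Bałaban's block averaging (a continuum theory
in the block-spin sense of the renormalization group).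

THE ARGUMENT.  (i) `T3ThresholdRemoval.exists_tendsto_integral_unitLaw`: under (E3), `∫ f dμ_K` converges for every CONTINUOUS
GAUGE-INVARIANT `f` (Lévy's density theorem [Levy2004] Thm 3.1 on the unit three-torus + ε/3).  (ii) The unit laws `μ_K` are
gauge invariant (`T3UnitLawGaugeInvariance.map_gaugeAct_unitLaw`), so `∫ g dμ_K = ∫ ḡ dμ_K` for every continuous `g`, where
`ḡ(U) = ∫ g(U^{v}) dv` is the ORBIT AVERAGE over the Haar probability measure of the gauge group `SU(2)^{sites(T₁)}` — continuous
(dominated convergence), gauge invariant (right invariance of Haar), bounded (§2; Fubini).  (iii) Hence `∫ g dμ_K` converges for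
EVERY continuous `g`, which on the compact metrisable space `SU(2)^{bonds(T₁)}` is weak convergence to a unique Borel probability
measure (tree kernel `T4LimitLaw.tendsto_of_forall_tendsto_integral_prod`; continuous functions separate points).  Conversely weak
convergence gives (E3) because the string observables are continuous at `ℰ = expMeanLogSUc` (tree `BlockAveraging.continuous_holAt`).
(iv) Consistency: `μ^{F}_{K+n} = (Π_n)_* μ^{F.refine n}_K` with `Π_n = unitShift n ∘ avg^{n} ∘ fieldShift` CONTINUOUS
(`T3LevelShift` bookkeeping + [Balaban1987RG1] (0.11) + tree `continuous_iter_blockAvg_expMeanLogSUc`), and push-forward under a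
continuous map is weakly continuous.

## Contents

(§1–§2 = sibling module `T3OrbitAverage`: topology of `SU(N)^{bonds}`, the orbit average and its Fubini identity.)
§3 (`SU(2)`, `ℰc`) `tendsto_integral_unitLaw_of_hasContinuumLimit` (all continuous `g`), `unitLawPM`,
   **`hasContinuumLimit_iff_tendsto_unitLaw`**, `continuumUnitLaw` with `tendsto_continuumUnitLaw`,
   `tendsto_integral_continuumUnitLaw`, `tendsto_expectAt_integral_continuumUnitLaw` (moments = continuum loop expectations),
   `eq_continuumUnitLaw_of_tendsto` (uniqueness), `exists_subseq_tendsto_unitLaw` (tightness is free),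
   **`hasContinuumLimit_iff_unitLaw_limits_agree`** ((E3) ⇔ uniqueness of the limit unit law), `map_gaugeAct_continuumUnitLaw`
   (gauge invariance), `map_ctwist_continuumUnitLaw` (centre symmetry, via `T3CentreTwistUnitLaw`).
§4 `coarsen F n` (`= Π_n`), `continuous_coarsen`, `unitA_refine` (map-level refinement identity), `unitLaw_add_eq_map_coarsen`,
   **`continuumUnitLaw_eq_map_refine`**: `ν^{F} = (Π_n)_* ν^{F.refine n}`.
-/

noncomputable section

open MeasureTheory Filter Topology BoundedContinuousFunction
open Literature.MathematicalPhysics.QuantumFieldTheory.Balaban1983to89.T3ContinuumYM3Torus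
open Literature.MathematicalPhysics.QuantumFieldTheory.Balaban1983to89.T3LevelShift
open Literature.MathematicalPhysics.QuantumFieldTheory.Balaban1983to89.T3ThresholdRemoval
open Literature.MathematicalPhysics.QuantumFieldTheory.Balaban1983to89.T3UnitLawGaugeInvariance
open Literature.MathematicalPhysics.QuantumFieldTheory.Balaban1983to89.T3OrbitAverage
open Literature.MathematicalPhysics.QuantumFieldTheory.Balaban1983to89.T3CentreTwistUnitLaw
open Literature.MathematicalPhysics.QuantumFieldTheory.Balaban1983to89.Missing
open Literature.MathematicalPhysics.QuantumFieldTheory.Balaban1983to89.T4Continuum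
open Literature.MathematicalPhysics.QuantumFieldTheory.Balaban1983to89.B12RTGaugeInvariance254 (measurable_gaugeAct)

namespace Literature.MathematicalPhysics.QuantumFieldTheory.Balaban1983to89.T3ContinuumUnitLaw

/-- Products of a list of continuous real functions are continuous (local helper). [folklore] -/
private theorem continuous_list_prod {X : Type*} [TopologicalSpace X] {ι : Type*} (f : ι → X → ℝ)
    (hf : ∀ i, Continuous (f i)) : ∀ l : List ι, Continuous fun x => (l.map fun i => f i x).prod
  | [] => by simpa using continuous_const
  | i :: l => by
    show Continuous fun x => f i x * (l.map fun i => f i x).prod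
    exact (hf i).mul (continuous_list_prod f hf l)

/-- Products of a list of measurable real functions are measurable (local helper). [folklore] -/
private theorem measurable_list_prod {X : Type*} [MeasurableSpace X] {ι : Type*} (f : ι → X → ℝ)
    (hf : ∀ i, Measurable (f i)) : ∀ l : List ι, Measurable fun x => (l.map fun i => f i x).prod
  | [] => by simp
  | i :: l => by
    show Measurable fun x => f i x * (l.map fun i => f i x).prod
    exact (hf i).mul (measurable_list_prod f hf l)

/-- Two finite measures related by `∫ f ∘ φ dμ = ∫ f dν` for all measurable `f` with `|f| ≤ 1` satisfy `φ_* μ = ν`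
(test on indicators; local helper, copy of the one in `T3UnitLawGaugeInvariance`). [folklore] -/
private theorem map_eq_of_integral_comp_eq {X Y : Type*} [MeasurableSpace X] [MeasurableSpace Y] {μ : Measure X}
    {ν : Measure Y} [IsFiniteMeasure μ] [IsFiniteMeasure ν] {φ : X → Y} (hφ : Measurable φ)
    (h : ∀ f : Y → ℝ, Measurable f → (∀ y, |f y| ≤ 1) → ∫ x, f (φ x) ∂μ = ∫ y, f y ∂ν) : μ.map φ = ν := by
  refine Measure.ext fun s hs => ?_
  have hi : Measurable (s.indicator (1 : Y → ℝ)) := measurable_one.indicator hs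
  have hb : ∀ y, |s.indicator (1 : Y → ℝ) y| ≤ 1 := fun y => by
    by_cases hy : y ∈ s
    · simp [hy]
    · simp [hy]
  have h1 := h _ hi hb
  have h3 : (fun x => s.indicator (1 : Y → ℝ) (φ x)) = (φ ⁻¹' s).indicator 1 := by
    funext x
    by_cases hx : φ x ∈ s
    · simp [hx]
    · simp [hx]
  rw [Measure.map_apply hφ hs]
  have h2 : μ.real (φ ⁻¹' s) = ν.real s := by
    rw [← integral_indicator_one (hφ hs), ← integral_indicator_one hs, ← h1, h3]
  exact (ENNReal.toReal_eq_toReal_iff' (measure_ne_top _ _) (measure_ne_top _ _)).mp h2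

/-! ## §3 `SU(2)`, `ℰ = expMeanLogSUc`: (E3) ⇔ weak convergence of the unit laws; THE continuum unit law -/

section UnitLaw

variable (F : T3Family) {γ : ℝ} (hγ : 0 ≤ γ)

/-- The unit law of step `K` as a bundled probability measure on `SU(2)^{bonds(T₁)}`. [cite: Balaban1985UV3, (1)-(3) p.256] -/
def unitLawPM (K : ℕ) : ProbabilityMeasure (GaugeField (F.P 0) 0 (Matrix.specialUnitaryGroup (Fin 2) ℂ)) :=
  ⟨F.unitLaw ℰc measurableE_expMeanLogSUc γ K, isProbabilityMeasure_unitLaw measurableE_expMeanLogSUc hγ K⟩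

/-- [cite: Balaban1985UV3, (1)-(3) p.256] -/
@[simp] theorem toMeasure_unitLawPM (K : ℕ) :
    ((unitLawPM F hγ K : ProbabilityMeasure _) : Measure _) = F.unitLaw ℰc measurableE_expMeanLogSUc γ K :=
  rfl

include hγ in
/-- **(E3) ⇒ `∫ g d(unitLaw K)` CONVERGES FOR EVERY CONTINUOUS `g`** (not only gauge-invariant ones): orbit-average `g`
(§2, the unit laws being gauge invariant) and apply `T3ThresholdRemoval.exists_tendsto_integral_unitLaw` (Lévy + ε/3).
[cite: Levy2004, Thm 3.1] -/
theorem tendsto_integral_unitLaw_of_hasContinuumLimit (h : HasContinuumLimit (F.scheme ℰc γ))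
    {g : GaugeField (F.P 0) 0 (Matrix.specialUnitaryGroup (Fin 2) ℂ) → ℝ} (hg : Continuous g) :
    ∃ l, Tendsto (fun K => ∫ u, g u ∂F.unitLaw ℰc measurableE_expMeanLogSUc γ K) atTop (𝓝 l) := by
  obtain ⟨C, hC⟩ := isCompact_univ.exists_bound_of_continuousOn (hg.continuousOn (s := Set.univ))
  have hC' : ∀ U, |g U| ≤ C := fun U => by
    have hU := hC U (Set.mem_univ _)
    rwa [Real.norm_eq_abs] at hU
  obtain ⟨l, hl⟩ := exists_tendsto_integral_unitLaw F hγ h (continuous_orbAvg hg)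
    (fun u U => orbAvg_gaugeAct g u U) (measurable_orbAvg hg) (abs_orbAvg_le hC')
  refine ⟨l, ?_⟩
  have he : (fun K => ∫ u, g u ∂F.unitLaw ℰc measurableE_expMeanLogSUc γ K) =
      fun K => ∫ u, orbAvg g u ∂F.unitLaw ℰc measurableE_expMeanLogSUc γ K := funext fun K => by
    haveI := isProbabilityMeasure_unitLaw (F := F) (ℰ := ℰc) measurableE_expMeanLogSUc hγ K
    exact integral_eq_integral_orbAvg _ (fun v => map_gaugeAct_unitLaw F ℰc measurableE_expMeanLogSUc hγ K v) hg
  rw [he]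
  exact hl

include hγ in
/-- **(E3) ⇔ WEAK CONVERGENCE OF THE UNIT LAWS** (`SU(2)`, `ℰ = expMeanLogSUc`, `γ ≥ 0`): the full-sequence continuum limit of
all joint expectations of unit-scale averaged loop variables exists iff the unit laws `μ_K` converge weakly to a Borel probability
measure on the compact space `SU(2)^{bonds(T₁)}` (⇒: §2 + compactness/uniqueness kernel
`T4LimitLaw.tendsto_of_forall_tendsto_integral_prod`;
⇐: the string observables are continuous at `ℰc`). [cite: JaffeWittenClay2006, §6.5 p.11] -/
theorem hasContinuumLimit_iff_tendsto_unitLaw :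
    HasContinuumLimit (F.scheme ℰc γ) ↔
      ∃ ν : ProbabilityMeasure (GaugeField (F.P 0) 0 (Matrix.specialUnitaryGroup (Fin 2) ℂ)),
        Tendsto (unitLawPM F hγ) atTop (𝓝 ν) := by
  constructor
  · intro h
    have hc : ∀ l : List C(GaugeField (F.P 0) 0 (Matrix.specialUnitaryGroup (Fin 2) ℂ), ℝ), ∃ c : ℝ,
        Tendsto (fun K => ∫ x, (l.map fun f : C(_, ℝ) => f x).prod
          ∂(unitLawPM F hγ K : Measure (GaugeField (F.P 0) 0 (Matrix.specialUnitaryGroup (Fin 2) ℂ)))) atTop (𝓝 c) :=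
      fun l => tendsto_integral_unitLaw_of_hasContinuumLimit F hγ h
        (continuous_list_prod (fun (f : C(_, ℝ)) (x : GaugeField (F.P 0) 0 _) => f x) (fun f => f.continuous) l)
    exact (T4LimitLaw.exists_tendsto_iff_forall_integral_prod_convergent (e := fun f : C(_, ℝ) => f)
      continuousMap_separatesPoints (unitLawPM F hγ)).mpr hc
  · rintro ⟨ν, hν⟩ Cs
    have hcont : Continuous fun u : GaugeField (F.P 0) 0 (Matrix.specialUnitaryGroup (Fin 2) ℂ) =>
        (Cs.map fun C : ULoop3 F => loopAt u (C.1.atLevel 0)).prod :=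
      continuous_list_prod (fun (C : ULoop3 F) (u : GaugeField (F.P 0) 0 _) => loopAt u (C.1.atLevel 0))
        (fun C => continuous_loopAt _) Cs
    refine ⟨∫ u, (Cs.map fun C : ULoop3 F => loopAt u (C.1.atLevel 0)).prod
      ∂(ν : Measure (GaugeField (F.P 0) 0 (Matrix.specialUnitaryGroup (Fin 2) ℂ))), ?_⟩
    have ht := (ProbabilityMeasure.tendsto_iff_forall_integral_tendsto.mp hν) (mkOfCompact ⟨_, hcont⟩)
    refine ht.congr' (Eventually.of_forall fun K => ?_)
    show _ = (F.scheme ℰc γ).expectAt K Cs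
    rw [expectAt_eq_integral_unitLaw measurableE_expMeanLogSUc hγ K Cs]
    rfl

/-- **THE CONTINUUM UNIT LAW** of `(F, γ)` under (E3): the weak limit of the unit laws — ONE gauge-invariant Borel probability
measure on `SU(2)^{bonds(T₁)}`, the law of the unit-scale (0.4)-smeared bond variables of continuum `SU(2)` Yang–Mills on the
three-torus `F`. [cite: JaffeWittenClay2006, §6.5 p.11] -/
def continuumUnitLaw (h : HasContinuumLimit (F.scheme ℰc γ)) :
    ProbabilityMeasure (GaugeField (F.P 0) 0 (Matrix.specialUnitaryGroup (Fin 2) ℂ)) :=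
  Classical.choose ((hasContinuumLimit_iff_tendsto_unitLaw F hγ).mp h)

/-- The unit laws converge weakly to the continuum unit law. [cite: JaffeWittenClay2006, §6.5 p.11] -/
theorem tendsto_continuumUnitLaw (h : HasContinuumLimit (F.scheme ℰc γ)) :
    Tendsto (unitLawPM F hγ) atTop (𝓝 (continuumUnitLaw F hγ h)) :=
  Classical.choose_spec ((hasContinuumLimit_iff_tendsto_unitLaw F hγ).mp h)

/-- `∫ g dμ_K → ∫ g dν` for every continuous `g`. [cite: JaffeWittenClay2006, §6.5 p.11] -/
theorem tendsto_integral_continuumUnitLaw (h : HasContinuumLimit (F.scheme ℰc γ))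
    {g : GaugeField (F.P 0) 0 (Matrix.specialUnitaryGroup (Fin 2) ℂ) → ℝ} (hg : Continuous g) :
    Tendsto (fun K => ∫ u, g u ∂F.unitLaw ℰc measurableE_expMeanLogSUc γ K) atTop
      (𝓝 (∫ u, g u ∂(continuumUnitLaw F hγ h : Measure (GaugeField (F.P 0) 0 (Matrix.specialUnitaryGroup (Fin 2) ℂ))))) :=
  (ProbabilityMeasure.tendsto_iff_forall_integral_tendsto.mp (tendsto_continuumUnitLaw F hγ h)) (mkOfCompact ⟨g, hg⟩)

/-- **THE CONTINUUM LOOP EXPECTATIONS ARE THE MOMENTS OF THE CONTINUUM UNIT LAW**: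
`⟨∏_{C∈Cs} W̄_C⟩_K → ∫ ∏_C W_C dν`. [cite: JaffeWittenClay2006, §6.5 p.11] -/
theorem tendsto_expectAt_integral_continuumUnitLaw (h : HasContinuumLimit (F.scheme ℰc γ)) (Cs : List (ULoop3 F)) :
    Tendsto (fun K => (F.scheme ℰc γ).expectAt K Cs) atTop
      (𝓝 (∫ u, (Cs.map fun C : ULoop3 F => loopAt u (C.1.atLevel 0)).prod
        ∂(continuumUnitLaw F hγ h : Measure (GaugeField (F.P 0) 0 (Matrix.specialUnitaryGroup (Fin 2) ℂ))))) := by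
  have hcont : Continuous fun u : GaugeField (F.P 0) 0 (Matrix.specialUnitaryGroup (Fin 2) ℂ) =>
      (Cs.map fun C : ULoop3 F => loopAt u (C.1.atLevel 0)).prod :=
    continuous_list_prod (fun (C : ULoop3 F) (u : GaugeField (F.P 0) 0 _) => loopAt u (C.1.atLevel 0))
      (fun C => continuous_loopAt _) Cs
  refine (tendsto_integral_continuumUnitLaw F hγ h hcont).congr' (Eventually.of_forall fun K => ?_)
  show _ = (F.scheme ℰc γ).expectAt K Cs
  rw [expectAt_eq_integral_unitLaw measurableE_expMeanLogSUc hγ K Cs]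

/-- **UNIQUENESS**: any weak limit of the unit laws (along the full sequence) is the continuum unit law.
[cite: JaffeWittenClay2006, §6.5 p.11] -/
theorem eq_continuumUnitLaw_of_tendsto (h : HasContinuumLimit (F.scheme ℰc γ))
    {ν : ProbabilityMeasure (GaugeField (F.P 0) 0 (Matrix.specialUnitaryGroup (Fin 2) ℂ))}
    (hν : Tendsto (unitLawPM F hγ) atTop (𝓝 ν)) : ν = continuumUnitLaw F hγ h :=
  T4LimitLaw.probabilityMeasure_eq_of_forall_integral_prod_eq (e := fun f : C(_, ℝ) => f) continuousMap_separatesPoints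
    fun l => tendsto_nhds_unique (T4LimitLaw.tendsto_integral_prod_of_tendsto (fun f : C(_, ℝ) => f) hν l)
      (T4LimitLaw.tendsto_integral_prod_of_tendsto (fun f : C(_, ℝ) => f) (tendsto_continuumUnitLaw F hγ h) l)

/-- **TIGHTNESS IS FREE**: the unit laws always have weakly convergent subsequences (`SU(2)^{bonds(T₁)}` is compact
metrisable) — «at least through a compactness argument using a subsequence» (MRS); the content of (E3) is elsewhere.
[cite: MagnenRivasseauSeneor1993, p.326] -/
theorem exists_subseq_tendsto_unitLaw :
    ∃ (ν : ProbabilityMeasure (GaugeField (F.P 0) 0 (Matrix.specialUnitaryGroup (Fin 2) ℂ))) (φ : ℕ → ℕ),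
      StrictMono φ ∧ Tendsto (unitLawPM F hγ ∘ φ) atTop (𝓝 ν) :=
  T4LimitDensity.exists_subseq_tendsto_of_compactSpace (unitLawPM F hγ)

/-- A weak limit along a subsequence coincides with the weak limit along the full sequence (when the latter exists).
[cite: JaffeWittenClay2006, §6.5 p.11] -/
theorem eq_of_tendsto_unitLaw_along {ν ν₀ : ProbabilityMeasure (GaugeField (F.P 0) 0 (Matrix.specialUnitaryGroup (Fin 2) ℂ))}
    {φ : ℕ → ℕ} (hφ : Tendsto φ atTop atTop) (h : Tendsto (unitLawPM F hγ) atTop (𝓝 ν₀))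
    (hν : Tendsto (unitLawPM F hγ ∘ φ) atTop (𝓝 ν)) : ν = ν₀ :=
  T4LimitLaw.probabilityMeasure_eq_of_forall_integral_prod_eq (e := fun f : C(_, ℝ) => f) continuousMap_separatesPoints
    fun l => tendsto_nhds_unique (T4LimitLaw.tendsto_integral_prod_of_tendsto (fun f : C(_, ℝ) => f) hν l)
      ((T4LimitLaw.tendsto_integral_prod_of_tendsto (fun f : C(_, ℝ) => f) h l).comp hφ)

/-- **(E3) ⇔ ALL SUBSEQUENTIAL WEAK LIMITS OF THE UNIT LAWS COINCIDE** (`SU(2)`, `ℰ = expMeanLogSUc`): existence of limit points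
being free (`exists_subseq_tendsto_unitLaw`), the d = 3 expectations step is EXACTLY the uniqueness of the limit unit law —
MRS p. 326: «the limit is not necessarily unique. Clearly this is a point which requires further work.» [cite: MagnenRivasseauSeneor1993, p.326] -/
theorem hasContinuumLimit_iff_unitLaw_limits_agree :
    HasContinuumLimit (F.scheme ℰc γ) ↔
      ∀ (ν ν' : ProbabilityMeasure (GaugeField (F.P 0) 0 (Matrix.specialUnitaryGroup (Fin 2) ℂ))) (φ ψ : ℕ → ℕ),
        Tendsto φ atTop atTop → Tendsto ψ atTop atTop →
          Tendsto (unitLawPM F hγ ∘ φ) atTop (𝓝 ν) → Tendsto (unitLawPM F hγ ∘ ψ) atTop (𝓝 ν') → ν = ν' := by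
  rw [hasContinuumLimit_iff_tendsto_unitLaw F hγ]
  constructor
  · rintro ⟨ν₀, h⟩ ν ν' φ ψ hφ hψ hν hν'
    rw [eq_of_tendsto_unitLaw_along F hγ hφ h hν, eq_of_tendsto_unitLaw_along F hγ hψ h hν']
  · intro huniq
    obtain ⟨ν₀, φ₀, hφ₀, h₀⟩ := T4LimitDensity.exists_subseq_tendsto_of_compactSpace (unitLawPM F hγ)
    refine ⟨ν₀, tendsto_of_subseq_tendsto fun ns hns => ?_⟩
    obtain ⟨ν', ms, hms, h'⟩ := T4LimitDensity.exists_subseq_tendsto_of_compactSpace (unitLawPM F hγ ∘ ns)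
    refine ⟨ms, ?_⟩
    have hlim : Tendsto (unitLawPM F hγ ∘ (ns ∘ ms)) atTop (𝓝 ν') := h'
    have heq := huniq ν' ν₀ (ns ∘ ms) φ₀ (hns.comp hms.tendsto_atTop) hφ₀.tendsto_atTop hlim h₀
    rw [← heq]
    exact h'

/-- **THE CONTINUUM UNIT LAW IS GAUGE INVARIANT** (weak limits of invariant laws under a continuous action).
[cite: Balaban1985Averaging, (12) p.19] -/
theorem map_gaugeAct_continuumUnitLaw (h : HasContinuumLimit (F.scheme ℰc γ))
    (v : GaugeTransf (F.P 0) 0 (Matrix.specialUnitaryGroup (Fin 2) ℂ)) :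
    (continuumUnitLaw F hγ h : Measure (GaugeField (F.P 0) 0 (Matrix.specialUnitaryGroup (Fin 2) ℂ))).map
      (GaugeField.gaugeAct v) = continuumUnitLaw F hγ h := by
  haveI : IsProbabilityMeasure ((continuumUnitLaw F hγ h : Measure
      (GaugeField (F.P 0) 0 (Matrix.specialUnitaryGroup (Fin 2) ℂ))).map (GaugeField.gaugeAct v)) :=
    Measure.isProbabilityMeasure_map (measurable_gaugeAct v).aemeasurable
  refine T4LimitLaw.measure_eq_of_forall_integral_prod_eq (e := fun f : C(_, ℝ) => f) continuousMap_separatesPoints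
    fun l => ?_
  have hcont : Continuous fun x : GaugeField (F.P 0) 0 (Matrix.specialUnitaryGroup (Fin 2) ℂ) =>
      (l.map fun f : C(_, ℝ) => f x).prod :=
    continuous_list_prod (fun (f : C(_, ℝ)) (x : GaugeField (F.P 0) 0 _) => f x) (fun f => f.continuous) l
  rw [integral_map (measurable_gaugeAct v).aemeasurable hcont.aestronglyMeasurable]
  -- both sides are limits of the same sequence `∫ ∏ f dμ_K` (the unit laws being invariant)
  refine tendsto_nhds_unique ?_ (tendsto_integral_continuumUnitLaw F hγ h hcont)
  refine (tendsto_integral_continuumUnitLaw F hγ h (hcont.comp (continuous_gaugeAct v))).congr' ?_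
  exact Eventually.of_forall fun K =>
    integral_unitLaw_comp_gaugeAct F ℰc measurableE_expMeanLogSUc hγ K v hcont.measurable

/-- A centre twist acts continuously on `SU(2)^{bonds(T₁)}` (bondwise: multiplication by a constant or the identity).
[cite: tHooft1979Flux, §2] -/
theorem continuous_ctwist (z : Matrix.specialUnitaryGroup (Fin 2) ℂ) (μ : Fin 3) (s : ZMod ((F.P 0).sitesPerDir 0)) :
    Continuous (GaugeField.ctwist z μ s :
      GaugeField (F.P 0) 0 (Matrix.specialUnitaryGroup (Fin 2) ℂ) → GaugeField (F.P 0) 0 (Matrix.specialUnitaryGroup (Fin 2) ℂ)) := by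
  refine continuous_pi fun b => ?_
  have hb : Continuous fun U : GaugeField (F.P 0) 0 (Matrix.specialUnitaryGroup (Fin 2) ℂ) => U b := continuous_apply b
  by_cases h : b.dir = μ ∧ b.src μ = s
  · simp only [GaugeField.ctwist_apply, h, and_self, if_true]
    exact continuous_const.mul hb
  · simp only [GaugeField.ctwist_apply, h, if_false]
    exact hb

/-- **THE CONTINUUM UNIT LAW IS CENTRE SYMMETRIC**: invariant under every centre twist of the unit torus (central `z ∈ SU(2)`,
every axis, every slice) — weak limits of twist-invariant laws (`T3CentreTwistUnitLaw.map_ctwist_unitLaw`) under a continuous map;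
the law-level form of 't Hooft's electric centre symmetry in the continuum (cf. `T3CentreSymmetry`: odd-winding loop strings
have zero expectation). [cite: tHooft1979Flux, §2] -/
theorem map_ctwist_continuumUnitLaw {z : Matrix.specialUnitaryGroup (Fin 2) ℂ}
    (hz : ∀ g : Matrix.specialUnitaryGroup (Fin 2) ℂ, z * g = g * z) (h : HasContinuumLimit (F.scheme ℰc γ)) (μ : Fin 3)
    (s : ZMod ((F.P 0).sitesPerDir 0)) :
    (continuumUnitLaw F hγ h : Measure (GaugeField (F.P 0) 0 (Matrix.specialUnitaryGroup (Fin 2) ℂ))).map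
      (GaugeField.ctwist z μ s) = continuumUnitLaw F hγ h := by
  have hmeas : Measurable (GaugeField.ctwist z μ s :
      GaugeField (F.P 0) 0 (Matrix.specialUnitaryGroup (Fin 2) ℂ) → GaugeField (F.P 0) 0 (Matrix.specialUnitaryGroup (Fin 2) ℂ)) :=
    (GaugeField.measurePreserving_ctwist z μ s).measurable
  haveI : IsProbabilityMeasure ((continuumUnitLaw F hγ h : Measure
      (GaugeField (F.P 0) 0 (Matrix.specialUnitaryGroup (Fin 2) ℂ))).map (GaugeField.ctwist z μ s)) :=
    Measure.isProbabilityMeasure_map hmeas.aemeasurable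
  refine T4LimitLaw.measure_eq_of_forall_integral_prod_eq (e := fun f : C(_, ℝ) => f) continuousMap_separatesPoints
    fun l => ?_
  have hcont : Continuous fun x : GaugeField (F.P 0) 0 (Matrix.specialUnitaryGroup (Fin 2) ℂ) =>
      (l.map fun f : C(_, ℝ) => f x).prod :=
    continuous_list_prod (fun (f : C(_, ℝ)) (x : GaugeField (F.P 0) 0 _) => f x) (fun f => f.continuous) l
  rw [integral_map hmeas.aemeasurable hcont.aestronglyMeasurable]
  refine tendsto_nhds_unique ?_ (tendsto_integral_continuumUnitLaw F hγ h hcont)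
  refine (tendsto_integral_continuumUnitLaw F hγ h (hcont.comp (continuous_ctwist F z μ s))).congr' ?_
  exact Eventually.of_forall fun K =>
    integral_unitLaw_comp_ctwist F ℰc measurableE_expMeanLogSUc hz hγ K μ s hcont.measurable

end UnitLaw

/-! ## §4 Consistency under block averaging across resolutions -/

section Consistency

variable (F : T3Family) (n : ℕ)

/-- Continuity of the level identifications (coordinate reindexing; local helper). [folklore] -/
private theorem continuous_fieldShift {m K j m' K' j' : ℕ} {G : Type*} [TopologicalSpace G]
    (h : (F.PP m K).sitesPerDir j = (F.PP m' K').sitesPerDir j') :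
    Continuous (fieldShift h : GaugeField (F.PP m' K') j' G → GaugeField (F.PP m K) j G) :=
  continuous_pi fun _ => continuous_apply _

section Maps

variable {G : Type*} [GaugeGroup G] (ℰ : LoopAverage G)

/-- **THE COARSENING MAP `Π_n`**: a configuration of the REFINED family's unit torus (`2L^{m+n}` sites per direction), block
averaged `n` more times by (0.4) and read on the original unit labels — the unit field of `F` as a function of the unit field of
`F.refine n` ([Balaban1987RG1] (0.11)). [cite: Balaban1987RG1, (0.11) p.253] -/
def coarsen (u : GaugeField ((F.refine n).P 0) 0 G) : GaugeField (F.P 0) 0 G :=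
  unitShift F n (Averaging.iter (fun j => BlockAveraging.blockAvg (P := F.P n) (j := j) ℰ) n
    (fieldShift (sitesPerDir_refine_unit F n) u))

/-- The original string read on the refined unit field (`T3ThresholdRemoval.coarseObs`) is the unit string observable of the
coarsened configuration. [cite: Balaban1987RG1, (0.11) p.253] -/
theorem coarseObs_eq_prod_loopAt_coarsen (Cs : List (ULoop3 F)) (u : GaugeField ((F.refine n).P 0) 0 G) :
    coarseObs F n ℰ Cs u = (Cs.map fun C : ULoop3 F => loopAt (coarsen F n ℰ u) (C.1.atLevel 0)).prod := by
  unfold coarseObs coarsen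
  simp_rw [F.avgObs_eq_loopAt_unitShift ℰ n]

/-- **THE MAP-LEVEL REFINEMENT IDENTITY** `A^{F}_{K+n} ∘ fieldShift = Π_n ∘ A^{F.refine n}_K`: the unit field of `F` at step
`K + n`, computed from a fine configuration read on the refined family's `K`-th finest lattice, is the coarsening of the refined
family's unit field at step `K` (`avg^{K+n} = avg^{n} ∘ avg^{K}` across the towers, `T3LevelShift`).
[cite: Balaban1987RG1, (0.11) p.253] -/
theorem unitA_refine (K : ℕ) (V : GaugeField (F.PP (F.m + n) K) 0 G) :
    unitShift F (K + n) (Averaging.iter (fun j => BlockAveraging.blockAvg (P := F.P (K + n)) (j := j) ℰ) (K + n)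
        (fieldShift (sitesPerDir_refine_zero F n K) V)) =
      coarsen F n ℰ (unitShift (F.refine n) K
        (Averaging.iter (fun j => BlockAveraging.blockAvg (P := F.PP (F.m + n) K) (j := j) ℰ) K V)) := by
  show fieldShift (F.sitesPerDir_unit (K + n))
      (Averaging.iter (fun j => BlockAveraging.blockAvg (P := F.PP F.m (K + n)) (j := j) ℰ) (K + n)
        (fieldShift (sitesPerDir_refine_zero F n K) V)) =
    fieldShift (F.sitesPerDir_unit n) (Averaging.iter (fun j => BlockAveraging.blockAvg (P := F.PP F.m n) (j := j) ℰ) n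
      (fieldShift (sitesPerDir_refine_unit F n) (fieldShift (sitesPerDir_refine_top F n K)
        (Averaging.iter (fun j => BlockAveraging.blockAvg (P := F.PP (F.m + n) K) (j := j) ℰ) K V))))
  rw [T4AvgSensitivity.iter_add, iter_fieldShift ℰ (show F.m + (K + n) = F.m + n + K by omega) K V,
    fieldShift_fieldShift (sitesPerDir_refine_unit F n) (sitesPerDir_refine_top F n K)]
  rw [← fieldShift_fieldShift
    (F.sitesPerDir_eq (m := F.m) (K := n) (j := 0) (m' := F.m) (K' := K + n) (j' := K) (by omega))
    (F.sitesPerDir_eq (m := F.m) (K := K + n) (j := K) (m' := F.m + n) (K' := K) (j' := K) (by omega))]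
  rw [← iterFrom_fieldShift ℰ (show F.m + (K + n) = F.m + n + K by omega) n, fieldShift_fieldShift]

variable [MeasurableSpace G] [RegularGaugeGroup G]

/-- `coarsen` is measurable (measurable `ℰ`). [cite: Balaban1987RG1, (0.4) p.253] -/
theorem measurable_coarsen (hE : ℰ.MeasurableE) :
    Measurable (coarsen F n ℰ : GaugeField ((F.refine n).P 0) 0 G → GaugeField (F.P 0) 0 G) :=
  (measurable_unitShift F n).comp ((measurable_iter _ (F.avgMeasurable_of_measurableE ℰ hE n) n).comp
    (measurable_fieldShift _))

variable [HaarData G]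

/-- **THE UNIT LAWS ACROSS RESOLUTIONS**: `unitLaw^{F}_{K+n} = (Π_n)_* unitLaw^{F.refine n}_K` at the rescaled coupling
`γL^{-n}` — the original family's unit law is the image of the refined family's under `n` block averagings (`expectAt_refine` at the
level of laws). [cite: Balaban1985UV3, (1)-(3) p.256] -/
theorem unitLaw_add_eq_map_coarsen (hE : ℰ.MeasurableE) {γ : ℝ} (hγ : 0 ≤ γ) (K : ℕ) :
    F.unitLaw ℰ hE γ (K + n) =
      ((F.refine n).unitLaw ℰ hE (γ * ((F.L : ℝ)⁻¹) ^ n) K).map (coarsen F n ℰ) := by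
  have hγ' : 0 ≤ γ * ((F.L : ℝ)⁻¹) ^ n := mul_nonneg hγ (pow_nonneg (inv_nonneg.mpr (Nat.cast_nonneg _)) _)
  haveI := isProbabilityMeasure_unitLaw (F := F) (ℰ := ℰ) hE hγ (K + n)
  haveI := isProbabilityMeasure_unitLaw (F := F.refine n) (ℰ := ℰ) hE hγ' K
  symm
  refine map_eq_of_integral_comp_eq (measurable_coarsen F n ℰ hE) fun f hf _ => ?_
  rw [integral_unitLaw hE (K + n) hf]
  refine (integral_unitLaw (F := F.refine n) hE K (hf.comp (measurable_coarsen F n ℰ hE))).trans ?_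
  rw [T3Family.refine_β]
  show ∫ V, f (coarsen F n ℰ (unitShift (F.refine n) K
      (Averaging.iter (fun j => BlockAveraging.blockAvg (P := F.PP (F.m + n) K) (j := j) ℰ) K V)))
      ∂T4GenFunBounds.gibbsMeasure (F.PP (F.m + n) K) ((F.scheme ℰ γ).β (K + n)) =
    ∫ U, f (unitShift F (K + n)
      (Averaging.iter (fun j => BlockAveraging.blockAvg (P := F.PP F.m (K + n)) (j := j) ℰ) (K + n) U))
      ∂T4GenFunBounds.gibbsMeasure (F.PP F.m (K + n)) ((F.scheme ℰ γ).β (K + n))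
  rw [← integral_gibbsMeasure_comp_fieldShift (sitesPerDir_refine_zero F n K) (F.scheme_β_nonneg ℰ hγ (K + n))
    (fun U => f (unitShift F (K + n)
      (Averaging.iter (fun j => BlockAveraging.blockAvg (P := F.PP F.m (K + n)) (j := j) ℰ) (K + n) U)))]
  refine integral_congr_ae (Eventually.of_forall fun V => ?_)
  exact congrArg f (unitA_refine F n ℰ K V).symm

end Maps

/-- `Π_n` is CONTINUOUS at `ℰ = expMeanLogSUc` (tree `BlockAveraging.continuous_iter_blockAvg_expMeanLogSUc`).
[cite: Balaban1987RG1, (0.4) p.253] -/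
theorem continuous_coarsen {N : ℕ} [NeZero N] :
    Continuous (coarsen F n (ExpMeanLog.expMeanLogSUc (n := Fin N)) :
      GaugeField ((F.refine n).P 0) 0 (Matrix.specialUnitaryGroup (Fin N) ℂ) → GaugeField (F.P 0) 0 _) :=
  (continuous_fieldShift F _).comp ((BlockAveraging.continuous_iter_blockAvg_expMeanLogSUc n).comp
    (continuous_fieldShift F _))

variable {γ : ℝ} (hγ : 0 ≤ γ)

/-- The rescaled coupling is non-negative. [cite: Balaban1985UV3, (1)-(3) p.256] -/
theorem refine_coupling_nonneg (hγ : 0 ≤ γ) : 0 ≤ γ * ((F.L : ℝ)⁻¹) ^ n :=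
  mul_nonneg hγ (pow_nonneg (inv_nonneg.mpr (Nat.cast_nonneg _)) _)

/-- **CONSISTENCY OF THE CONTINUUM UNIT LAWS UNDER BLOCK AVERAGING** (`SU(2)`, `ℰ = expMeanLogSUc`): if the refined family
`(F.refine n, γL^{-n})` satisfies (E3) — hence so does `(F, γ)`, `T3ThresholdRemoval.hasContinuumLimit_of_refine` — then the
continuum unit law of `F` is the image of that of `F.refine n` under `n` block averagings:  `ν^{F} = (Π_n)_* ν^{F.refine n}`.
The continuum laws at the resolutions `L^{-n}`, `n ≥ 0`, are ONE consistent family (a continuum theory in the block-spin sense).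
[cite: Balaban1987RG1, (0.11) p.253] -/
theorem continuumUnitLaw_eq_map_refine
    (h : HasContinuumLimit ((F.refine n).scheme ℰc (γ * ((F.L : ℝ)⁻¹) ^ n))) :
    continuumUnitLaw F hγ (hasContinuumLimit_of_refine F n hγ h) =
      (continuumUnitLaw (F.refine n) (refine_coupling_nonneg F n hγ) h).map
        (continuous_coarsen F n (N := 2)).measurable.aemeasurable := by
  symm
  refine eq_continuumUnitLaw_of_tendsto F hγ (hasContinuumLimit_of_refine F n hγ h) ?_
  -- `(Π_n)_* μ'^K → (Π_n)_* ν'` and `(Π_n)_* μ'^K = μ^F_{K+n}`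
  have hmap := ProbabilityMeasure.tendsto_map_of_tendsto_of_continuous _ _
    (tendsto_continuumUnitLaw (F.refine n) (refine_coupling_nonneg F n hγ) h) (continuous_coarsen F n (N := 2))
  have hshift : Tendsto (fun K => unitLawPM F hγ (K + n)) atTop
      (𝓝 ((continuumUnitLaw (F.refine n) (refine_coupling_nonneg F n hγ) h).map
        (continuous_coarsen F n (N := 2)).measurable.aemeasurable)) := by
    refine hmap.congr fun K => ?_
    apply ProbabilityMeasure.toMeasure_injective
    rw [ProbabilityMeasure.toMeasure_map, toMeasure_unitLawPM, toMeasure_unitLawPM,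
      unitLaw_add_eq_map_coarsen F n ℰc measurableE_expMeanLogSUc hγ K]
  exact (tendsto_add_atTop_iff_nat n).mp hshift

end Consistency

end Literature.MathematicalPhysics.QuantumFieldTheory.Balaban1983to89.T3ContinuumUnitLaw

end
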